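import Literature.MathematicalPhysics.QuantumFieldTheory.Balaban1983to89.B1Eq324BenfattoKernelSect5Eq515
import Literature.MathematicalPhysics.QuantumFieldTheory.Balaban1983to89.B1Eq324BenfattoClassCrossRowMassMoment
import HarnessLib

/-!
# `Balaban1983to89.B1Eq324BenfattoKernelSect5PartFieldRows` — [BenfattoEtAl1978] §5 (5.16)–(5.33) pp. 156–159, Appendix C (C.2)–(C.8)
# p. 164 for the class of [Balaban1985BackgroundPropagators] Sect. E p. 428: THE DEPTH ROWS OF THE PART FIELDS — the displayed hypotheses of
# the cluster-side port (rows (a)–(f) of seat n08-c's `…KernelSect5PerBoxAtPavement`: kernel bounds, ℓ¹-decay, the centre on the region,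
# the DEPTH smallness of the centre and of `K_□ − K`, the Lemma-2 rows) DISCHARGED from the class data of a coercive, Combes–Thomas-decaying
# precision, PROVED

statement-level skeleton of published theorems with citation tags; proofs where landed; nothing here is a claim about the
Yang–Mills mass gap

WHY THIS MODULE (cell `pub-ymgap`, width seat `dag-n08-w5`; the «depth rows» module of seat n08-c gen 31's cluster-side port map
`N08-PORT-MAP-CLUSTER-SIDE.md` §1 (optional row), handed to this seat 2026-08-28T07:46Z; node N08 [Balaban1985UV3]; the [BenfattoEtAl1978] source
chain behind the (α)-row `h324`).  The class road's pavement step (seat n08-d, `…KernelSect5PavementStep.pavementStep_of_setIntegral`) is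
joined to the cluster side (seat n08-c, rows 1–10, `…KernelSect5PerBoxAtPavement.pavementStep_of_clusterRows`) at the PART FIELDS
`N^K_{□,ξ} = (gaussianFieldOfKernel (Kb m)).map (u_{Γ₁}(ξ) + ·)`, `Kb m` = the zero extension of `(A|_{□})⁻¹`, `□ = □′ ∪ Γ₂(□) = shrink L m w`,
`u_{Γ₁}(ξ) = condMean K Γ₁ ξ`, `Γ₁ = corridors L w B`.  That junction DISPLAYS, uniformly in `m ∈ B` and in the datum `ξ ∈ χ^{Γ₁}_{γb}`, the rows
(a) `|Kb m x y| ≤ K₀`, `|K x y| ≤ K₀`; (b) `|Kb m x y| ≤ K₀e^{−δ₀·ℓ¹(x,y)}`; (c) `|u_{Γ₁}(ξ)_y| ≤ Kᵤ` on `I`; (d) `|u_{Γ₁}(ξ)_x| ≤ ε₃₁` and (e)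
`|Kb m x y − K x y| ≤ ε₃₁` for `x ∈ shrink L m (w + (w − v))` (depth `w − v`); (f) `Kb m x x ≤ ½` and `|u_{Γ₁}(ξ)_x| ≤ ½b(1 + d(Δ_x, I))` on
`shrink L m w`.  This file DISCHARGES ALL SIX from the class data alone — `A` symmetric and `γ_A`-coercive on `Λ`, Combes–Thomas row
`Σ_{e′}|A e e′|(cosh(θ·dist e e′) − 1) ≤ J < γ_A` for a pseudometric `dist` dominating the Euclidean site distance (seat n08-d's «rows of record in
ℓ²»: take `dist = ℓ²`), the growth rows `V`, `M` of J1 F5, the half-rate rows `V₂`, `M₂` of J1 F7 and a quarter-rate growth row `V₄` — by READING seat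
n08-d's J1 (`…KernelOfPrecision` F2/F5/F7/(C.4)) at the part data `(shrink L m w, A|_{□})` (the row `hKb` IS J1's `hK` there) and at the full data
`(Λ, A)`, plus ONE new estimate: a DECAYING form of F5 (`abs_condMean_le_sum_exp`: the centre is controlled by the boundary data within `O(1/θ)` of
the site), which makes the centre small at depth `w − v`.  The constants are explicit: `K₀`-type bounds `1/(γ_A − J)`, `δ₀ = θ/√d`, `Kᵤ = (1 + VM/(γ_A − J))γb`,
`ε₃₁ ≥ (M₂/(γ_A − J))·γb·(1 + √d(L − 1))·V₄·e^{−(θ/4)(w − v)}` (d) and `ε₃₁ ≥ V₂M₂/(γ_A − J)²·e^{−(θ/2)(w − v)} + e^{−θ(w − v)}/(γ_A − J)` (e).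

WHAT IS PROVED (standard axioms; no `sorry`; no definition).
* §0 (kernels) the part precision `A|_{□}` along the inclusion `↥□ → Λ` inherits symmetry, `γ_A`-coercivity and every non-negative row bound;
  `ℓ¹ ≤ √d·ℓ²`.
* §1 THE PART KERNEL (rows (a), (b), (f) kernel half; every `m ∈ B`, all `x y`): ★ `abs_partKernel_le_exp` (`|Kb m x y| ≤ e^{−θ·dist x y}/(γ_A − J)`,
  J1 F2 at the part data), `abs_partKernel_le` (`≤ 1/(γ_A − J)`), `abs_kernel_le` (`|K x y| ≤ 1/(γ_A − J)`), ★ `abs_partKernel_le_exp_l1`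
  (`|Kb m x y| ≤ (1/(γ_A − J))·e^{−(θ/√d)·ℓ¹(x,y)}` — row (b) with `δ₀ = θ/√d`), `partKernel_self_le` (`Kb m x x ≤ 1/γ_A` — row (f) kernel half under the
  displayed class condition `1/γ_A ≤ ½`), `kernel_self_le'`.
* §2 THE CENTRE (rows (c), (f) centre half; `Γ₁ = corridors L w B ⊆ Λ`, data `ξ ∈ smallFieldOn ↑Γ₁ I (γb)`): ★ `abs_condMean_le_on_region`
  (`∀ y ∈ I, |condMean K Γ₁ ξ y| ≤ (1 + VM/(γ_A − J))·γb` — J1 F5 at `δ := d(Δ_·, I)` (1-Lipschitz in `ℓ²`, `…ClassCrossRowMassMoment` v1.1) off `Γ₁`,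
  the reproducing property on `Γ₁`, zero off `Λ`), ★ `abs_condMean_le_profile_on_shrink` (`∀ m ∈ B, ∀ x ∈ shrink L m w, |condMean K Γ₁ ξ x| ≤
  (VM/(γ_A − J))·γb·(1 + d(Δ_x, I))`) and `abs_condMean_le_half_profile_on_shrink` (row (f) centre half under the displayed smallness
  `(VM/(γ_A − J))·γ ≤ ½`).
* §3 ROW (e): `partKernel_eq_condCov` (`Kb m x y = condCov K (Λ ∖ shrink L m w) x y` on the box — J1's Dirichlet identity re-indexed to the box),
  ★★ `abs_partKernel_sub_kernel_le` (`x ∈ shrink L m (w + (w − v))`, any `y`: `|Kb m x y − K x y| ≤ V₂M₂/(γ_A − J)²·e^{−(θ/2)(w − v)} + e^{−θ(w − v)}/(γ_A − J)`;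
  J1 F7 inside the box, J1 F2 outside), `abs_partKernel_sub_kernel_le_of_le` (the row with any `ε₃₁` above that constant).
* §4 ROW (d): ★★ `abs_condMean_le_sum_exp` (THE DECAYING F5: `|condMean K Γ ξ x| ≤ (M₂/(γ_A − J))·Σ_{c∈Γ}e^{−(θ/2)dist x c}|ξ_c|`, from seat n08-b's
  `…ClassAppendixC.abs_regression_le` through J1's bridge), ★★ `abs_condMean_le_deep` (`|condMean K Γ₁ ξ x| ≤ (M₂/(γ_A − J))·γb·(1 + √d(L − 1))·V₄·e^{−(θ/4)(w − v)}`
  on `shrink L m (w + (w − v))`, every tessera of `B` meeting `I`), `abs_condMean_le_deep_of_le`.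
HONEST SCOPE.  Assembly by name over J1 / class Appendix C / the §5 geometry plus one decay estimate; the class and its rows are OURS, not print;
nothing of [Balaban1985UV3] / [Balaban1985UV2] is asserted; no generalised Basic Lemma is stated; the §5-side port is not commissioned (plan
words (G) §n08) — a located row-discharge module of it, nothing chained; count-neutral for N08; nothing about d = 4, the continuum, OS axioms,
a mass gap or the Clay problem.
-/

noncomputable section

open Finset Matrix
open scoped BigOperators

namespace Literature.MathematicalPhysics.QuantumFieldTheory.Balaban1983to89.B1Eq324BenfattoKernelSect5PartFieldRows

open Literature.MathematicalPhysics.QuantumFieldTheory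
open Literature.MathematicalPhysics.QuantumFieldTheory.Balaban1983to89.B1Eq324BenfattoLemma
open Literature.MathematicalPhysics.QuantumFieldTheory.Balaban1983to89.B1Eq324BenfattoAppendixA (cubeDist_nonneg distToRegion_nonneg)
open Literature.MathematicalPhysics.QuantumFieldTheory.Balaban1983to89.B1Eq324BenfattoSect5Boxes
open Literature.MathematicalPhysics.QuantumFieldTheory.Balaban1983to89.B1Eq324BenfattoSect5SlotMoments (distToRegion_eq_zero_of_mem)
open Literature.MathematicalPhysics.QuantumFieldTheory.Balaban1983to89.B1Eq324BenfattoSect5Eq515 (smallFieldOn)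
open Literature.MathematicalPhysics.QuantumFieldTheory.Balaban1983to89.B1Eq324BenfattoKernelSect5Eq515 (shrink_subset_sdiff_corridors)
open Literature.MathematicalPhysics.QuantumFieldTheory.Balaban1983to89.B1Eq324BenfattoCondCentre (condMean_apply_of_mem)
open Literature.MathematicalPhysics.QuantumFieldTheory.Balaban1983to89.B1Eq324BenfattoClassAppendixC (posDef_of_coercive)
open Literature.MathematicalPhysics.QuantumFieldTheory.Balaban1983to89.B1Eq324BenfattoKernelOfPrecision
open Literature.MathematicalPhysics.QuantumFieldTheory.Balaban1983to89.B1Eq324BenfattoClassCrossRowMassMoment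
  (abs_distToRegion_sub_distToRegion_le_sqrt cubeDist_le_sqrt_sum_sq distToRegion_le_cubeDist_add_of_box_meets)

variable {d : ℕ}

/-! ## §0  Kernels: the part precision inherits the class; `ℓ¹ ≤ √d·ℓ²` -/

section Kernels

variable {Λ : Finset (B1Eq324BenfattoLemma.Site d)} {A : Matrix Λ Λ ℝ}

/-- kernel: a principal sub-precision along the inclusion of a sub-finset `P ⊆ Λ` is symmetric. [folklore] -/
private theorem submatrix_symm_of_subset (hAs : ∀ e e', A e e' = A e' e) {P : Finset (B1Eq324BenfattoLemma.Site d)} (hP : P ⊆ Λ) :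
    ∀ a b : ↥P, A.submatrix (fun j : ↥P => (⟨j, hP j.2⟩ : Λ)) (fun j : ↥P => (⟨j, hP j.2⟩ : Λ)) a b =
      A.submatrix (fun j : ↥P => (⟨j, hP j.2⟩ : Λ)) (fun j : ↥P => (⟨j, hP j.2⟩ : Λ)) b a :=
  fun _ _ => hAs _ _

/-- kernel: a sum over `↥P` of the pull-back of a non-negative function on `Λ` is at most the full sum. [folklore] -/
private theorem sum_subset_subtype_le {P : Finset (B1Eq324BenfattoLemma.Site d)} (hP : P ⊆ Λ) {g : ↥Λ → ℝ} (hg : ∀ e, 0 ≤ g e) :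
    ∑ y' : ↥P, g ⟨y', hP y'.2⟩ ≤ ∑ e : ↥Λ, g e := by
  let ι : ↥P ↪ ↥Λ :=
    ⟨fun y' => ⟨y', hP y'.2⟩, fun a b h => by
      simp only [Subtype.mk.injEq] at h
      exact Subtype.ext h⟩
  have h : ∑ y' : ↥P, g (ι y') ≤ ∑ e : ↥Λ, g e := by
    rw [← Finset.sum_map Finset.univ ι g]
    exact Finset.sum_le_univ_sum_of_nonneg hg
  exact h

/-- kernel: a principal sub-precision along `P ⊆ Λ` inherits every row bound with non-negative weights (fewer terms). [folklore] -/
private theorem rowBound_submatrix_of_subset {P : Finset (B1Eq324BenfattoLemma.Site d)} (hP : P ⊆ Λ) {wgt : ↥Λ → ↥Λ → ℝ}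
    (hw : ∀ e e', 0 ≤ wgt e e') {J : ℝ} (hJ : ∀ e : Λ, ∑ e' : Λ, |A e e'| * wgt e e' ≤ J) (y : ↥P) :
    ∑ y' : ↥P, |A.submatrix (fun j : ↥P => (⟨j, hP j.2⟩ : Λ)) (fun j : ↥P => (⟨j, hP j.2⟩ : Λ)) y y'| *
        wgt ⟨y, hP y.2⟩ ⟨y', hP y'.2⟩ ≤ J := by
  simp only [Matrix.submatrix_apply]
  exact (sum_subset_subtype_le hP (g := fun e' => |A ⟨y, hP y.2⟩ e'| * wgt ⟨y, hP y.2⟩ e')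
    fun e' => mul_nonneg (abs_nonneg _) (hw _ _)).trans (hJ ⟨y, hP y.2⟩)

/-- kernel: a principal sub-precision along `P ⊆ Λ` inherits coercivity with the SAME constant (seat n08-b's `coercive_submatrix` on the
`Λ`-indexed copy of `P`, transported along `↥P ≃ ↥(P_Λ)`). [folklore] -/
private theorem coercive_submatrix_of_subset {γ : ℝ} (hγ : ∀ x : Λ → ℝ, γ * ∑ e, x e ^ 2 ≤ ∑ e, ∑ e', A e e' * x e * x e')
    {P : Finset (B1Eq324BenfattoLemma.Site d)} (hP : P ⊆ Λ) (v : ↥P → ℝ) :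
    γ * ∑ y, v y ^ 2 ≤ ∑ y, ∑ y',
      A.submatrix (fun j : ↥P => (⟨j, hP j.2⟩ : Λ)) (fun j : ↥P => (⟨j, hP j.2⟩ : Λ)) y y' * v y * v y' := by
  classical
  set S : Finset ↥Λ := P.subtype (· ∈ Λ) with hS
  let e : ↥P ≃ ↥S :=
    { toFun := fun p => ⟨⟨p, hP p.2⟩, Finset.mem_subtype.mpr p.2⟩
      invFun := fun s => ⟨((s : Λ) : B1Eq324BenfattoLemma.Site d), Finset.mem_subtype.mp s.2⟩
      left_inv := fun p => Subtype.ext rfl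
      right_inv := fun s => Subtype.ext (Subtype.ext rfl) }
  have h := B1Eq324BenfattoClassAppendixC.coercive_submatrix hγ S (v ∘ e.symm)
  have h1 : ∑ s : ↥S, (v ∘ e.symm) s ^ 2 = ∑ y : ↥P, v y ^ 2 := by
    rw [← e.sum_comp]
    simp only [Function.comp_apply, Equiv.symm_apply_apply]
  have h2 : ∑ s : ↥S, ∑ s' : ↥S, A.submatrix (fun j : ↥S => (j : Λ)) (fun j : ↥S => (j : Λ)) s s' * (v ∘ e.symm) s * (v ∘ e.symm) s' =
      ∑ y : ↥P, ∑ y' : ↥P, A.submatrix (fun j : ↥P => (⟨j, hP j.2⟩ : Λ)) (fun j : ↥P => (⟨j, hP j.2⟩ : Λ)) y y' * v y * v y' := by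
    rw [← e.sum_comp]
    refine Finset.sum_congr rfl fun y _ => ?_
    rw [← e.sum_comp]
    refine Finset.sum_congr rfl fun y' _ => ?_
    simp only [Function.comp_apply, Equiv.symm_apply_apply, Matrix.submatrix_apply]
    rfl
  rw [h1, h2] at h
  exact h

/-- kernel: `ℓ¹ ≤ √d·ℓ²` on `Q₀` (Cauchy–Schwarz). [folklore] -/
private theorem l1_le_sqrt_mul_l2 (x y : B1Eq324BenfattoLemma.Site d) :
    ∑ j, |((x j : ℝ) - (y j : ℝ))| ≤ Real.sqrt d * Real.sqrt (∑ j, (((x j : ℝ) - (y j : ℝ))) ^ 2) := by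
  have h := Real.sum_mul_le_sqrt_mul_sqrt Finset.univ (fun j : Fin d => |((x j : ℝ) - (y j : ℝ))|) (fun _ => (1 : ℝ))
  simp only [mul_one, one_pow, Finset.sum_const, Finset.card_univ, Fintype.card_fin, nsmul_eq_mul, sq_abs] at h
  rw [mul_comm]
  exact h

end Kernels

/-! ## §1  The part kernel: rows (a), (b), and the kernel half of (f) -/

section PartKernel

variable {Λ : Finset (B1Eq324BenfattoLemma.Site d)} {A : Matrix Λ Λ ℝ}
  {K : B1Eq324BenfattoLemma.Site d → B1Eq324BenfattoLemma.Site d → ℝ}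
  (hK : ∀ x y, K x y = if h : x ∈ Λ ∧ y ∈ Λ then (A⁻¹ : Matrix Λ Λ ℝ) ⟨x, h.1⟩ ⟨y, h.2⟩ else 0)
  {L w : ℕ} {B : Finset (B1Eq324BenfattoLemma.Site d)} (hBΛ : ∀ m ∈ B, box L m ⊆ Λ)
  {Kb : B1Eq324BenfattoLemma.Site d → B1Eq324BenfattoLemma.Site d → B1Eq324BenfattoLemma.Site d → ℝ}
  (hKb : ∀ m (hm : m ∈ B) x y, Kb m x y = if h : x ∈ shrink L m w ∧ y ∈ shrink L m w then
    ((A.submatrix (fun j : ↥(shrink L m w) => (⟨j, hBΛ m hm (shrink_subset_box L m w j.2)⟩ : Λ))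
      (fun j : ↥(shrink L m w) => (⟨j, hBΛ m hm (shrink_subset_box L m w j.2)⟩ : Λ)))⁻¹ :
        Matrix ↥(shrink L m w) ↥(shrink L m w) ℝ) ⟨x, h.1⟩ ⟨y, h.2⟩ else 0)
  (hAs : ∀ e e', A e e' = A e' e) {γA : ℝ} (hγA0 : 0 < γA)
  (hγA : ∀ x : Λ → ℝ, γA * ∑ e, x e ^ 2 ≤ ∑ e, ∑ e', A e e' * x e * x e')
  {dist : B1Eq324BenfattoLemma.Site d → B1Eq324BenfattoLemma.Site d → ℝ}
  (hd0 : ∀ e, dist e e = 0) (hdsymm : ∀ e e', dist e e' = dist e' e) (hdtri : ∀ e e' e'', dist e e'' ≤ dist e e' + dist e' e'')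
  {J θ : ℝ}
  (hJ : ∀ e : Λ, ∑ e' : Λ, |A e e'| * (Real.cosh (θ * dist (e : B1Eq324BenfattoLemma.Site d) (e' : B1Eq324BenfattoLemma.Site d)) - 1) ≤ J)
  (hθ : 0 ≤ θ) (hJγ : J < γA)
  (hl2 : ∀ x y : B1Eq324BenfattoLemma.Site d, Real.sqrt (∑ j, (((x j : ℝ) - (y j : ℝ))) ^ 2) ≤ dist x y)

/-- kernel: a pseudometric dominating `ℓ²` is non-negative. [folklore] -/
private theorem dist_nonneg_of_l2 (hl2 : ∀ x y : B1Eq324BenfattoLemma.Site d, Real.sqrt (∑ j, (((x j : ℝ) - (y j : ℝ))) ^ 2) ≤ dist x y)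
    (x y : B1Eq324BenfattoLemma.Site d) : 0 ≤ dist x y :=
  (Real.sqrt_nonneg _).trans (hl2 x y)

include hKb hAs hγA0 hγA hd0 hdsymm hdtri hJ hθ hJγ in
/-- **ROW (b), EXPONENTIAL FORM — the part kernel decays with the class constants**: for every `m ∈ B` and all `x, y`,
`|Kb m x y| ≤ e^{−θ·dist x y}/(γ_A − J)` — J1 F2 `…KernelOfPrecision.abs_kernel_le_exp` READ AT THE PART DATA `(shrink L m w, A|_{□})` (the row `hKb`
is J1's `hK` there; the sub-precision is symmetric, `γ_A`-coercive and has Combes–Thomas row `≤ J` by §0).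
[cite: BenfattoEtAl1978, Appendix C (C.2), (C.6) p.164 (class form); Balaban1985BackgroundPropagators, Sect. E p.428] -/
theorem abs_partKernel_le_exp (m : B1Eq324BenfattoLemma.Site d) (hm : m ∈ B) (x y : B1Eq324BenfattoLemma.Site d) :
    |Kb m x y| ≤ Real.exp (-(θ * dist x y)) / (γA - J) :=
  abs_kernel_le_exp (hKb m hm)
    (submatrix_symm_of_subset hAs fun _ hj => hBΛ m hm (shrink_subset_box L m w hj))
    hd0 hdsymm hdtri hγA0
    (coercive_submatrix_of_subset hγA fun _ hj => hBΛ m hm (shrink_subset_box L m w hj))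
    (fun e => rowBound_submatrix_of_subset (fun _ hj => hBΛ m hm (shrink_subset_box L m w hj))
      (wgt := fun e e' : ↥Λ => Real.cosh (θ * dist (e : B1Eq324BenfattoLemma.Site d) (e' : B1Eq324BenfattoLemma.Site d)) - 1)
      (fun e e' => by linarith [Real.one_le_cosh (θ * dist (e : B1Eq324BenfattoLemma.Site d) (e' : B1Eq324BenfattoLemma.Site d))])
      hJ e)
    hθ hJγ x y

include hKb hAs hγA0 hγA hd0 hdsymm hdtri hJ hθ hJγ hl2 in
/-- **ROW (a) for the part kernel**: `|Kb m x y| ≤ 1/(γ_A − J)` for every `m ∈ B` and all `x, y` (the exponential is `≤ 1` as `dist ≥ 0`).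
[cite: BenfattoEtAl1978, Appendix C (C.2), (C.6) p.164 (class form)] -/
theorem abs_partKernel_le (m : B1Eq324BenfattoLemma.Site d) (hm : m ∈ B) (x y : B1Eq324BenfattoLemma.Site d) :
    |Kb m x y| ≤ 1 / (γA - J) := by
  have hγJ : 0 < γA - J := by linarith
  refine (abs_partKernel_le_exp hBΛ hKb hAs hγA0 hγA hd0 hdsymm hdtri hJ hθ hJγ m hm x y).trans ?_
  refine div_le_div_of_nonneg_right ?_ hγJ.le
  exact Real.exp_le_one_iff.mpr (neg_nonpos.mpr (mul_nonneg hθ (dist_nonneg_of_l2 hl2 x y)))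

include hK hAs hγA0 hγA hd0 hdsymm hdtri hJ hθ hJγ hl2 in
/-- **ROW (a) for the class kernel itself**: `|K x y| ≤ 1/(γ_A − J)` for all `x, y` (J1 F2, exponential `≤ 1`).
[cite: BenfattoEtAl1978, Appendix C (C.2) p.164 (class form)] -/
theorem abs_kernel_le (x y : B1Eq324BenfattoLemma.Site d) : |K x y| ≤ 1 / (γA - J) := by
  have hγJ : 0 < γA - J := by linarith
  refine (abs_kernel_le_exp hK hAs hd0 hdsymm hdtri hγA0 hγA hJ hθ hJγ x y).trans ?_
  refine div_le_div_of_nonneg_right ?_ hγJ.le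
  exact Real.exp_le_one_iff.mpr (neg_nonpos.mpr (mul_nonneg hθ (dist_nonneg_of_l2 hl2 x y)))

include hKb hAs hγA0 hγA hd0 hdsymm hdtri hJ hθ hJγ hl2 in
/-- **ROW (b) — the part kernel decays at the `ℓ¹` rate `θ/√d`**: `|Kb m x y| ≤ (1/(γ_A − J))·exp(−(θ/√d)·Σ_j|x_j − y_j|)` for every `m ∈ B`
and all `x, y` (`ℓ¹ ≤ √d·ℓ² ≤ √d·dist`; seat n08-d LOCATED the rate change `δ₀ := θ/√d`).
[cite: BenfattoEtAl1978, Appendix C (C.2), (C.6) p.164 (class form); §5 (5.31) p.158] -/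
theorem abs_partKernel_le_exp_l1 (m : B1Eq324BenfattoLemma.Site d) (hm : m ∈ B) (x y : B1Eq324BenfattoLemma.Site d) :
    |Kb m x y| ≤ 1 / (γA - J) * Real.exp (-(θ / Real.sqrt d * ∑ j, |((x j : ℝ) - (y j : ℝ))|)) := by
  have hγJ : 0 < γA - J := by linarith
  refine (abs_partKernel_le_exp hBΛ hKb hAs hγA0 hγA hd0 hdsymm hdtri hJ hθ hJγ m hm x y).trans ?_
  rw [div_eq_mul_inv, mul_comm, one_div]
  refine mul_le_mul_of_nonneg_left (Real.exp_le_exp.mpr (neg_le_neg ?_)) (inv_nonneg.mpr hγJ.le)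
  -- `(θ/√d)·ℓ¹ ≤ θ·dist`
  by_cases hd : d = 0
  · subst hd
    simp only [Finset.univ_eq_empty, Finset.sum_empty, mul_zero]
    exact mul_nonneg hθ (dist_nonneg_of_l2 hl2 x y)
  · have hsd : 0 < Real.sqrt d := Real.sqrt_pos.mpr (by exact_mod_cast Nat.pos_of_ne_zero hd)
    have h1 := l1_le_sqrt_mul_l2 x y
    have h2 := hl2 x y
    calc θ / Real.sqrt d * ∑ j, |((x j : ℝ) - (y j : ℝ))|
        ≤ θ / Real.sqrt d * (Real.sqrt d * Real.sqrt (∑ j, (((x j : ℝ) - (y j : ℝ))) ^ 2)) :=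
          mul_le_mul_of_nonneg_left h1 (div_nonneg hθ hsd.le)
      _ = θ * Real.sqrt (∑ j, (((x j : ℝ) - (y j : ℝ))) ^ 2) := by field_simp
      _ ≤ θ * dist x y := mul_le_mul_of_nonneg_left h2 hθ

include hKb hAs hγA0 hγA in
/-- **ROW (f), kernel half — the part variances**: `Kb m x x ≤ 1/γ_A` for every `m ∈ B` and every `x` (J1 (C.4) `kernel_self_le` at the part data);
the cluster side's `Kb m x x ≤ ½` is this under the DISPLAYED class condition `1/γ_A ≤ ½` (`partKernel_self_le_half`).
[cite: BenfattoEtAl1978, Appendix C (C.4), (C.6) p.164 (class form); Appendix C 2) Lemma 2 p.165] -/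
theorem partKernel_self_le (m : B1Eq324BenfattoLemma.Site d) (hm : m ∈ B) (x : B1Eq324BenfattoLemma.Site d) : Kb m x x ≤ 1 / γA :=
  (kernel_self_le (hKb m hm)
    (submatrix_symm_of_subset hAs fun _ hj => hBΛ m hm (shrink_subset_box L m w hj)) hγA0
    (coercive_submatrix_of_subset hγA fun _ hj => hBΛ m hm (shrink_subset_box L m w hj)) x).2

include hKb hAs hγA0 hγA in
/-- **ROW (f), kernel half, in the cluster side's letters**: if `1/γ_A ≤ ½` then `∀ m ∈ B, ∀ x ∈ shrink L m w, Kb m x x ≤ ½`.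
[cite: BenfattoEtAl1978, Appendix C 2) Lemma 2 p.165 (class form)] -/
theorem partKernel_self_le_half (hhalf : 1 / γA ≤ 1 / 2) :
    ∀ m ∈ B, ∀ x ∈ shrink L m w, Kb m x x ≤ 1 / 2 :=
  fun m hm x _ => (partKernel_self_le hBΛ hKb hAs hγA0 hγA m hm x).trans hhalf

include hK hAs hγA0 hγA in
/-- **The class kernel's variances**: `K x x ≤ 1/γ_A` for every `x` (J1 `kernel_self_le`). [cite: BenfattoEtAl1978, Appendix C (C.4) p.164 (class form)] -/
theorem kernel_self_le' (x : B1Eq324BenfattoLemma.Site d) : K x x ≤ 1 / γA :=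
  (kernel_self_le hK hAs hγA0 hγA x).2

end PartKernel

/-! ## §2  The centre: rows (c) and the centre half of (f) -/

section Centre

variable {Λ : Finset (B1Eq324BenfattoLemma.Site d)} {A : Matrix Λ Λ ℝ}
  {K : B1Eq324BenfattoLemma.Site d → B1Eq324BenfattoLemma.Site d → ℝ}
  (hK : ∀ x y, K x y = if h : x ∈ Λ ∧ y ∈ Λ then (A⁻¹ : Matrix Λ Λ ℝ) ⟨x, h.1⟩ ⟨y, h.2⟩ else 0)
  {L w : ℕ} {B I : Finset (B1Eq324BenfattoLemma.Site d)} (hL : 0 < L)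
  (hΓΛ : corridors L w B ⊆ Λ) (hBΛ : ∀ m ∈ B, box L m ⊆ Λ)
  (hAs : ∀ e e', A e e' = A e' e) {γA : ℝ} (hγA0 : 0 < γA)
  (hγA : ∀ x : Λ → ℝ, γA * ∑ e, x e ^ 2 ≤ ∑ e, ∑ e', A e e' * x e * x e')
  {dist : B1Eq324BenfattoLemma.Site d → B1Eq324BenfattoLemma.Site d → ℝ}
  (hd0 : ∀ e, dist e e = 0) (hdsymm : ∀ e e', dist e e' = dist e' e) (hdtri : ∀ e e' e'', dist e e'' ≤ dist e e' + dist e' e'')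
  {J θ : ℝ}
  (hJ : ∀ e : Λ, ∑ e' : Λ, |A e e'| * (Real.cosh (θ * dist (e : B1Eq324BenfattoLemma.Site d) (e' : B1Eq324BenfattoLemma.Site d)) - 1) ≤ J)
  (hθ : 0 ≤ θ) (hJγ : J < γA)
  (hl2 : ∀ x y : B1Eq324BenfattoLemma.Site d, Real.sqrt (∑ j, (((x j : ℝ) - (y j : ℝ))) ^ 2) ≤ dist x y)
  {V M : ℝ}
  (hV : ∀ e : Λ, ∑ e' : Λ, Real.exp (-(θ * dist (e : B1Eq324BenfattoLemma.Site d) (e' : B1Eq324BenfattoLemma.Site d))) *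
    (1 + dist (e : B1Eq324BenfattoLemma.Site d) (e' : B1Eq324BenfattoLemma.Site d)) ≤ V)
  (hM : ∀ e : Λ, ∑ e' : Λ, |A e e'| * (1 + dist (e : B1Eq324BenfattoLemma.Site d) (e' : B1Eq324BenfattoLemma.Site d)) ≤ M)
  {γ b : ℝ} (hγb : 0 ≤ γ * b)

/-- kernel: `d(Δ_·, I)` is 1-Lipschitz for any weight dominating `ℓ²`. [folklore] -/
private theorem distToRegion_le_add_dist
    (hl2 : ∀ x y : B1Eq324BenfattoLemma.Site d, Real.sqrt (∑ j, (((x j : ℝ) - (y j : ℝ))) ^ 2) ≤ dist x y)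
    (I : Finset (B1Eq324BenfattoLemma.Site d)) (e e' : B1Eq324BenfattoLemma.Site d) :
    distToRegion I e' ≤ distToRegion I e + dist e e' := by
  have h := (abs_sub_le_iff.mp (abs_distToRegion_sub_distToRegion_le_sqrt I e' e)).1
  have hsymm : Real.sqrt (∑ j, (((e' j : ℝ) - (e j : ℝ))) ^ 2) = Real.sqrt (∑ j, (((e j : ℝ) - (e' j : ℝ))) ^ 2) := by
    congr 1
    exact Finset.sum_congr rfl fun j _ => by ring
  rw [hsymm] at h
  linarith [hl2 e e']

include hK hAs hγA0 hγA hd0 hdsymm hdtri hJ hθ hJγ hl2 hV hM hγb in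
/-- **F5 AT THE PROFILE OF RECORD**: for `Γ ⊆ Λ`, data `ξ` with `|ξ_c| ≤ γb(1 + d(Δ_c, I))` on `Γ` (`γb ≥ 0`) and every `x ∈ Λ ∖ Γ`,
`|condMean K Γ ξ x| ≤ (VM/(γ_A − J))·γb·(1 + d(Δ_x, I))` — J1 F5 `abs_condMean_kernel_le_profile` at `δ := d(Δ_·, I)`, which is 1-Lipschitz for
`dist ≥ ℓ²` (`…ClassCrossRowMassMoment.abs_distToRegion_sub_distToRegion_le_sqrt`). [cite: BenfattoEtAl1978, Appendix C (C.8) p.164 (class form)] -/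
theorem abs_condMean_le_profile {Γ : Finset (B1Eq324BenfattoLemma.Site d)} (hΓ : Γ ⊆ Λ) (ξ : B1Eq324BenfattoLemma.Site d → ℝ)
    (hξ : ∀ c ∈ Γ, |ξ c| ≤ γ * b * (1 + distToRegion I c)) {x : B1Eq324BenfattoLemma.Site d} (hx : x ∈ Λ) (hxΓ : x ∉ Γ) :
    |condMean K Γ ξ x| ≤ V * M / (γA - J) * (γ * b) * (1 + distToRegion I x) :=
  abs_condMean_kernel_le_profile hK hAs hd0 hdsymm hdtri hγA0 hγA hJ hθ hJγ hV hM hγb (distToRegion I)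
    (distToRegion_nonneg I) (distToRegion_le_add_dist hl2 I) hΓ ξ hξ hx hxΓ

include hK hL hBΛ hAs hγA0 hγA hd0 hdsymm hdtri hJ hθ hJγ hl2 hV hM hγb in
/-- **ROW (f), centre half, raw form**: for every `m ∈ B`, every datum `ξ ∈ χ^{Γ₁}_{γb}` (`smallFieldOn ↑(corridors L w B) I (γb)`) and every
`x ∈ shrink L m w` (`⊆ Λ ∖ Γ₁`, `…KernelSect5Eq515.shrink_subset_sdiff_corridors`): `|condMean K Γ₁ ξ x| ≤ (VM/(γ_A − J))·γb·(1 + d(Δ_x, I))`.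
[cite: BenfattoEtAl1978, Appendix C (C.8) p.164 (class form); §5 (5.16) p.156] -/
theorem abs_condMean_le_profile_on_shrink (hΓΛ : corridors L w B ⊆ Λ) :
    ∀ m ∈ B, ∀ ξ ∈ smallFieldOn (corridors L w B : Set (B1Eq324BenfattoLemma.Site d)) I (γ * b),
      ∀ x ∈ shrink L m w, |condMean K (corridors L w B) ξ x| ≤ V * M / (γA - J) * (γ * b) * (1 + distToRegion I x) := by
  intro m hm ξ hξ x hx
  have hx' := Finset.mem_sdiff.mp (shrink_subset_sdiff_corridors hL hBΛ hm hx)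
  exact abs_condMean_le_profile hK hAs hγA0 hγA hd0 hdsymm hdtri hJ hθ hJγ hl2 hV hM hγb hΓΛ ξ
    (fun c hc => hξ c (Finset.mem_coe.mpr hc)) hx'.1 hx'.2

include hK hL hBΛ hAs hγA0 hγA hd0 hdsymm hdtri hJ hθ hJγ hl2 hV hM hγb in
/-- **ROW (f), centre half, in the cluster side's letters**: under the DISPLAYED smallness `(VM/(γ_A − J))·γ ≤ ½` (print: `γ` small) and `b ≥ 0`,
`∀ m ∈ B, ∀ ξ ∈ χ^{Γ₁}_{γb}, ∀ x ∈ shrink L m w, |condMean K Γ₁ ξ x| ≤ ½·b·(1 + d(Δ_x, I))` — the Lemma-2 centre row.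
[cite: BenfattoEtAl1978, Appendix C (C.8) p.164, Appendix C 2) Lemma 2 p.165 (class form); §5 (5.16) p.156] -/
theorem abs_condMean_le_half_profile_on_shrink (hΓΛ : corridors L w B ⊆ Λ) (hb : 0 ≤ b) (hsmall : V * M / (γA - J) * γ ≤ 1 / 2) :
    ∀ m ∈ B, ∀ ξ ∈ smallFieldOn (corridors L w B : Set (B1Eq324BenfattoLemma.Site d)) I (γ * b),
      ∀ x ∈ shrink L m w, |condMean K (corridors L w B) ξ x| ≤ 1 / 2 * b * (1 + distToRegion I x) := by
  intro m hm ξ hξ x hx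
  refine (abs_condMean_le_profile_on_shrink hK hL hBΛ hAs hγA0 hγA hd0 hdsymm hdtri hJ hθ hJγ hl2 hV hM hγb hΓΛ m hm ξ hξ x hx).trans ?_
  have h1 : 0 ≤ 1 + distToRegion I x := by linarith [distToRegion_nonneg I x]
  have h2 : V * M / (γA - J) * (γ * b) = V * M / (γA - J) * γ * b := by ring
  rw [h2]
  exact mul_le_mul_of_nonneg_right (mul_le_mul_of_nonneg_right hsmall hb) h1

include hK hAs hγA0 hγA hd0 hdsymm hdtri hJ hθ hJγ hl2 hV hM hγb in
/-- **ROW (c) — the centre on the region `I`**: for `Γ₁ = corridors L w B ⊆ Λ`, every datum `ξ ∈ χ^{Γ₁}_{γb}` and every `y ∈ I`,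
`|condMean K Γ₁ ξ y| ≤ (1 + VM/(γ_A − J))·γb` (`V, M ≥ 0`): off `Λ` the centre vanishes (J1 `condMean_kernel_eq_zero_of_not_mem`); on `Γ₁` it
reproduces the datum (`…CondCentre.condMean_apply_of_mem`), `|ξ_y| ≤ γb(1 + d(Δ_y, I)) = γb`; on `Λ ∖ Γ₁` F5 at `d(Δ_y, I) = 0`.
[cite: BenfattoEtAl1978, Appendix C (C.7)–(C.8) p.164 (class form); §5 (5.16)–(5.18) p.156] -/
theorem abs_condMean_le_on_region (hΓΛ : corridors L w B ⊆ Λ) (hV0 : 0 ≤ V) (hM0 : 0 ≤ M) :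
    ∀ ξ ∈ smallFieldOn (corridors L w B : Set (B1Eq324BenfattoLemma.Site d)) I (γ * b),
      ∀ y ∈ I, |condMean K (corridors L w B) ξ y| ≤ (1 + V * M / (γA - J)) * (γ * b) := by
  intro ξ hξ y hy
  have hγJ : 0 < γA - J := by linarith
  have hC0 : 0 ≤ V * M / (γA - J) := div_nonneg (mul_nonneg hV0 hM0) hγJ.le
  have hd : distToRegion I y = 0 := distToRegion_eq_zero_of_mem hy
  by_cases hyΛ : y ∈ Λ
  · by_cases hyΓ : y ∈ corridors L w B
    · -- the centre reproduces the datum on `Γ₁`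
      have hA : A.PosDef := posDef_of_coercive hAs hγA0 hγA
      rw [condMean_apply_of_mem K (corridors L w B) ξ (isUnit_det_covGram_kernel hK hA hΓΛ) hyΓ]
      have h1 := hξ y (Finset.mem_coe.mpr hyΓ)
      rw [hd, add_zero, mul_one] at h1
      refine h1.trans ?_
      nlinarith
    · have h1 := abs_condMean_le_profile hK hAs hγA0 hγA hd0 hdsymm hdtri hJ hθ hJγ hl2 hV hM hγb hΓΛ ξ
        (fun c hc => hξ c (Finset.mem_coe.mpr hc)) hyΛ hyΓ
      rw [hd, add_zero, mul_one] at h1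
      refine h1.trans ?_
      nlinarith
  · rw [condMean_kernel_eq_zero_of_not_mem hK (corridors L w B) ξ hyΛ, abs_zero]
    exact mul_nonneg (by linarith) hγb

end Centre

/-! ## §3  Row (e): the part kernel agrees with the class kernel deep inside the box -/

section Depth

variable {Λ : Finset (B1Eq324BenfattoLemma.Site d)} {A : Matrix Λ Λ ℝ}
  {K : B1Eq324BenfattoLemma.Site d → B1Eq324BenfattoLemma.Site d → ℝ}
  (hK : ∀ x y, K x y = if h : x ∈ Λ ∧ y ∈ Λ then (A⁻¹ : Matrix Λ Λ ℝ) ⟨x, h.1⟩ ⟨y, h.2⟩ else 0)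
  {L w v : ℕ} {B : Finset (B1Eq324BenfattoLemma.Site d)} (hBΛ : ∀ m ∈ B, box L m ⊆ Λ)
  {Kb : B1Eq324BenfattoLemma.Site d → B1Eq324BenfattoLemma.Site d → B1Eq324BenfattoLemma.Site d → ℝ}
  (hKb : ∀ m (hm : m ∈ B) x y, Kb m x y = if h : x ∈ shrink L m w ∧ y ∈ shrink L m w then
    ((A.submatrix (fun j : ↥(shrink L m w) => (⟨j, hBΛ m hm (shrink_subset_box L m w j.2)⟩ : Λ))
      (fun j : ↥(shrink L m w) => (⟨j, hBΛ m hm (shrink_subset_box L m w j.2)⟩ : Λ)))⁻¹ :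
        Matrix ↥(shrink L m w) ↥(shrink L m w) ℝ) ⟨x, h.1⟩ ⟨y, h.2⟩ else 0)
  (hAs : ∀ e e', A e e' = A e' e) {γA : ℝ} (hγA0 : 0 < γA)
  (hγA : ∀ x : Λ → ℝ, γA * ∑ e, x e ^ 2 ≤ ∑ e, ∑ e', A e e' * x e * x e')
  {dist : B1Eq324BenfattoLemma.Site d → B1Eq324BenfattoLemma.Site d → ℝ}
  (hd0 : ∀ e, dist e e = 0) (hdsymm : ∀ e e', dist e e' = dist e' e) (hdtri : ∀ e e' e'', dist e e'' ≤ dist e e' + dist e' e'')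
  {J θ : ℝ}
  (hJ : ∀ e : Λ, ∑ e' : Λ, |A e e'| * (Real.cosh (θ * dist (e : B1Eq324BenfattoLemma.Site d) (e' : B1Eq324BenfattoLemma.Site d)) - 1) ≤ J)
  (hθ : 0 ≤ θ) (hJγ : J < γA)
  (hl2 : ∀ x y : B1Eq324BenfattoLemma.Site d, Real.sqrt (∑ j, (((x j : ℝ) - (y j : ℝ))) ^ 2) ≤ dist x y)
  {V₂ M₂ : ℝ}
  (hV₂ : ∀ e : Λ, ∑ e' : Λ, Real.exp (-(θ / 2 * dist (e : B1Eq324BenfattoLemma.Site d) (e' : B1Eq324BenfattoLemma.Site d))) ≤ V₂)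
  (hM₂ : ∀ e : Λ, ∑ e' : Λ, |A e e'| * Real.exp (θ / 2 * dist (e : B1Eq324BenfattoLemma.Site d) (e' : B1Eq324BenfattoLemma.Site d)) ≤ M₂)

/-- kernel: deep sites are `≥ w − v` from everything outside `□′∪Γ₂(□)`, in any weight dominating `ℓ²`. [folklore] -/
private theorem sub_le_dist_of_deep
    (hl2 : ∀ x y : B1Eq324BenfattoLemma.Site d, Real.sqrt (∑ j, (((x j : ℝ) - (y j : ℝ))) ^ 2) ≤ dist x y)
    {m x c : B1Eq324BenfattoLemma.Site d} (hx : x ∈ shrink L m (w + (w - v))) (hc : c ∉ shrink L m w) :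
    ((w - v : ℕ) : ℝ) ≤ dist x c :=
  ((B1Eq324BenfattoSect5Eq524.le_cubeDist_of_mem_shrink_of_not_mem_shrink hx hc).trans (cubeDist_le_sqrt_sum_sq x c)).trans (hl2 x c)

include hK hKb hAs hγA0 hγA in
/-- **THE PART KERNEL IS THE CONDITIONAL COVARIANCE GIVEN THE OUTSIDE OF THE BOX**: for `m ∈ B` and `x, y ∈ □′∪Γ₂(□) = shrink L m w`,
`Kb m x y = condCov K (Λ ∖ shrink L m w) x y` — J1's «Dirichlet boundary condition» `condCov_kernel_eq_inv_submatrix` re-indexed from `Λ`'s copy of the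
box to the box itself (`Matrix.inv_submatrix_equiv`). [cite: BenfattoEtAl1978, Appendix C 2) (C.6)–(C.7) p.164 (class form); §5 (5.31) p.158] -/
theorem partKernel_eq_condCov (m : B1Eq324BenfattoLemma.Site d) (hm : m ∈ B) {x y : B1Eq324BenfattoLemma.Site d}
    (hx : x ∈ shrink L m w) (hy : y ∈ shrink L m w) :
    Kb m x y = condCov K (Λ \ shrink L m w) x y := by
  classical
  have hA : A.PosDef := posDef_of_coercive hAs hγA0 hγA
  have hPΛ : shrink L m w ⊆ Λ := fun j hj => hBΛ m hm (shrink_subset_box L m w hj)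
  have hxΛ : x ∈ Λ := hPΛ hx
  have hyΛ : y ∈ Λ := hPΛ hy
  have hxΓ : x ∉ Λ \ shrink L m w := fun h => (Finset.mem_sdiff.mp h).2 hx
  have hyΓ : y ∉ Λ \ shrink L m w := fun h => (Finset.mem_sdiff.mp h).2 hy
  rw [hKb m hm, dif_pos ⟨hx, hy⟩, condCov_kernel_eq_inv_submatrix hK hA Finset.sdiff_subset hxΛ hxΓ hyΛ hyΓ]
  -- re-index `↥(shrink L m w) ≃ ↥((Λ ∖ shrink)_Λ)ᶜ`
  let e : ↥(shrink L m w) ≃ ↥(((Λ \ shrink L m w).subtype (· ∈ Λ))ᶜ) :=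
    { toFun := fun p => ⟨⟨p, hPΛ p.2⟩, by
        rw [Finset.mem_compl, Finset.mem_subtype]
        exact fun h => (Finset.mem_sdiff.mp h).2 p.2⟩
      invFun := fun k => ⟨((k : Λ) : B1Eq324BenfattoLemma.Site d), by
        have hk := k.2
        rw [Finset.mem_compl, Finset.mem_subtype] at hk
        by_contra hnot
        exact hk (Finset.mem_sdiff.mpr ⟨(k : Λ).2, hnot⟩)⟩
      left_inv := fun p => Subtype.ext rfl
      right_inv := fun k => Subtype.ext (Subtype.ext rfl) }
  have hsub : A.submatrix (fun j : ↥(shrink L m w) => (⟨j, hBΛ m hm (shrink_subset_box L m w j.2)⟩ : Λ))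
        (fun j : ↥(shrink L m w) => (⟨j, hBΛ m hm (shrink_subset_box L m w j.2)⟩ : Λ)) =
      (A.submatrix (fun j : ↥(((Λ \ shrink L m w).subtype (· ∈ Λ))ᶜ) => (j : Λ))
        (fun j : ↥(((Λ \ shrink L m w).subtype (· ∈ Λ))ᶜ) => (j : Λ))).submatrix e e := by
    ext j j'
    rfl
  rw [hsub, Matrix.inv_submatrix_equiv]
  rfl

include hK hKb hAs hγA0 hγA hd0 hdsymm hdtri hJ hθ hJγ hl2 hV₂ hM₂ in
/-- **ROW (e) — deep inside the box the part kernel agrees with the class kernel**: for every `m ∈ B`, every `x ∈ shrink L m (w + (w − v))`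
(depth `≥ w − v` below the outside of `□′∪Γ₂(□)`) and EVERY `y`,
`|Kb m x y − K x y| ≤ V₂M₂/(γ_A − J)²·e^{−(θ/2)(w − v)} + e^{−θ(w − v)}/(γ_A − J)`:
for `y` in the box, J1 F7 `abs_kernel_sub_condCov_le_exp` at `Γ := Λ ∖ shrink L m w` with `D_x = w − v`, `D_y = 0` (§ `partKernel_eq_condCov`); for
`y` outside, `Kb m x y = 0` and J1 F2 with `dist x y ≥ w − v`. [cite: BenfattoEtAl1978, §5 (5.31) p.158, Appendix C (C.6)–(C.7) p.164 (class form)] -/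
theorem abs_partKernel_sub_kernel_le (m : B1Eq324BenfattoLemma.Site d) (hm : m ∈ B) {x : B1Eq324BenfattoLemma.Site d}
    (hx : x ∈ shrink L m (w + (w - v))) (y : B1Eq324BenfattoLemma.Site d) :
    |Kb m x y - K x y| ≤ V₂ * M₂ / (γA - J) ^ 2 * Real.exp (-(θ / 2 * ((w - v : ℕ) : ℝ))) +
      Real.exp (-(θ * ((w - v : ℕ) : ℝ))) / (γA - J) := by
  classical
  have hγJ : 0 < γA - J := by linarith
  have hPΛ : shrink L m w ⊆ Λ := fun j hj => hBΛ m hm (shrink_subset_box L m w hj)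
  have hxw : x ∈ shrink L m w := shrink_mono L m (Nat.le_add_right w (w - v)) hx
  have hxΛ : x ∈ Λ := hPΛ hxw
  -- the two summands are non-negative
  have hV0 : 0 ≤ V₂ := le_trans (Finset.sum_nonneg fun e' _ => (Real.exp_pos _).le) (hV₂ ⟨x, hxΛ⟩)
  have hM0 : 0 ≤ M₂ := le_trans (Finset.sum_nonneg fun e' _ => mul_nonneg (abs_nonneg _) (Real.exp_pos _).le) (hM₂ ⟨x, hxΛ⟩)
  have hT1 : 0 ≤ V₂ * M₂ / (γA - J) ^ 2 * Real.exp (-(θ / 2 * ((w - v : ℕ) : ℝ))) := by positivity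
  have hT2 : 0 ≤ Real.exp (-(θ * ((w - v : ℕ) : ℝ))) / (γA - J) := div_nonneg (Real.exp_pos _).le hγJ.le
  by_cases hy : y ∈ shrink L m w
  · -- F7 at `Γ := Λ ∖ shrink L m w`
    have hyΛ : y ∈ Λ := hPΛ hy
    have hxΓ : x ∉ Λ \ shrink L m w := fun h => (Finset.mem_sdiff.mp h).2 hxw
    have hyΓ : y ∉ Λ \ shrink L m w := fun h => (Finset.mem_sdiff.mp h).2 hy
    rw [partKernel_eq_condCov hK hBΛ hKb hAs hγA0 hγA m hm hxw hy, abs_sub_comm]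
    have h := abs_kernel_sub_condCov_le_exp hK hAs hd0 hdsymm hdtri hγA0 hγA hJ hθ hJγ hV₂ hM₂ Finset.sdiff_subset hxΛ hxΓ hyΛ hyΓ
      (Dx := ((w - v : ℕ) : ℝ)) (Dy := 0)
      (fun c hc => sub_le_dist_of_deep hl2 hx (Finset.mem_sdiff.mp hc).2)
      (fun c _ => (Real.sqrt_nonneg _).trans (hl2 c y))
    rw [add_zero] at h
    linarith
  · -- outside the box the part kernel vanishes; F2 for `K`
    rw [kernel_eq_zero_of_not_mem_right (hKb m hm) x hy, zero_sub, abs_neg]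
    have h := abs_kernel_le_exp hK hAs hd0 hdsymm hdtri hγA0 hγA hJ hθ hJγ x y
    have hdist : ((w - v : ℕ) : ℝ) ≤ dist x y := sub_le_dist_of_deep hl2 hx hy
    have h2 : Real.exp (-(θ * dist x y)) / (γA - J) ≤ Real.exp (-(θ * ((w - v : ℕ) : ℝ))) / (γA - J) :=
      div_le_div_of_nonneg_right (Real.exp_le_exp.mpr (neg_le_neg (mul_le_mul_of_nonneg_left hdist hθ))) hγJ.le
    linarith

include hK hKb hAs hγA0 hγA hd0 hdsymm hdtri hJ hθ hJγ hl2 hV₂ hM₂ in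
/-- **ROW (e) in the cluster side's letters**: with `ε₃₁ ≥ V₂M₂/(γ_A − J)²·e^{−(θ/2)(w − v)} + e^{−θ(w − v)}/(γ_A − J)`,
`∀ m ∈ B, ∀ x ∈ shrink L m (w + (w − v)), ∀ y, |Kb m x y − K x y| ≤ ε₃₁`. [cite: BenfattoEtAl1978, §5 (5.31) p.158 (class form)] -/
theorem abs_partKernel_sub_kernel_le_of_le {ε₃₁ : ℝ}
    (hε : V₂ * M₂ / (γA - J) ^ 2 * Real.exp (-(θ / 2 * ((w - v : ℕ) : ℝ))) + Real.exp (-(θ * ((w - v : ℕ) : ℝ))) / (γA - J) ≤ ε₃₁) :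
    ∀ m ∈ B, ∀ x ∈ shrink L m (w + (w - v)), ∀ y, |Kb m x y - K x y| ≤ ε₃₁ :=
  fun m hm _ hx y => (abs_partKernel_sub_kernel_le hK hBΛ hKb hAs hγA0 hγA hd0 hdsymm hdtri hJ hθ hJγ hl2 hV₂ hM₂ m hm hx y).trans hε

end Depth

/-! ## §4  Row (d): the centre is small deep inside the box (a decaying form of J1 F5) -/

section CentreDepth

variable {Λ : Finset (B1Eq324BenfattoLemma.Site d)} {A : Matrix Λ Λ ℝ}
  {K : B1Eq324BenfattoLemma.Site d → B1Eq324BenfattoLemma.Site d → ℝ}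
  (hK : ∀ x y, K x y = if h : x ∈ Λ ∧ y ∈ Λ then (A⁻¹ : Matrix Λ Λ ℝ) ⟨x, h.1⟩ ⟨y, h.2⟩ else 0)
  {L w v : ℕ} {B I : Finset (B1Eq324BenfattoLemma.Site d)} (hL : 0 < L) (hBΛ : ∀ m ∈ B, box L m ⊆ Λ)
  (hAs : ∀ e e', A e e' = A e' e) {γA : ℝ} (hγA0 : 0 < γA)
  (hγA : ∀ x : Λ → ℝ, γA * ∑ e, x e ^ 2 ≤ ∑ e, ∑ e', A e e' * x e * x e')
  {dist : B1Eq324BenfattoLemma.Site d → B1Eq324BenfattoLemma.Site d → ℝ}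
  (hd0 : ∀ e, dist e e = 0) (hdsymm : ∀ e e', dist e e' = dist e' e) (hdtri : ∀ e e' e'', dist e e'' ≤ dist e e' + dist e' e'')
  {J θ : ℝ}
  (hJ : ∀ e : Λ, ∑ e' : Λ, |A e e'| * (Real.cosh (θ * dist (e : B1Eq324BenfattoLemma.Site d) (e' : B1Eq324BenfattoLemma.Site d)) - 1) ≤ J)
  (hθ : 0 ≤ θ) (hJγ : J < γA)
  (hl2 : ∀ x y : B1Eq324BenfattoLemma.Site d, Real.sqrt (∑ j, (((x j : ℝ) - (y j : ℝ))) ^ 2) ≤ dist x y)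
  {M₂ : ℝ}
  (hM₂ : ∀ e : Λ, ∑ e' : Λ, |A e e'| * Real.exp (θ / 2 * dist (e : B1Eq324BenfattoLemma.Site d) (e' : B1Eq324BenfattoLemma.Site d)) ≤ M₂)
  {V₄ : ℝ}
  (hV₄ : ∀ e : Λ, ∑ e' : Λ, Real.exp (-(θ / 4 * dist (e : B1Eq324BenfattoLemma.Site d) (e' : B1Eq324BenfattoLemma.Site d))) *
    (1 + dist (e : B1Eq324BenfattoLemma.Site d) (e' : B1Eq324BenfattoLemma.Site d)) ≤ V₄)
  {γ b : ℝ} (hγb : 0 ≤ γ * b)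

include hK hAs hγA0 hγA hd0 hdsymm hdtri hJ hθ hJγ hl2 hM₂ in
/-- **F5, DECAYING FORM — the centre is controlled by the nearby boundary data only**: for `Γ ⊆ Λ`, any datum `ξ` and `x ∈ Λ ∖ Γ`,
`|condMean K Γ ξ x| ≤ (M₂/(γ_A − J))·Σ_{c ∈ Γ} e^{−(θ/2)·dist x c}|ξ_c|` with the half-rate weighted row `Σ_{e′}|A e e′|e^{(θ/2)dist e e′} ≤ M₂`:
J1's bridge `condMean_kernel_eq_regression` + seat n08-b's `…ClassAppendixC.abs_regression_le` (`|u_x| ≤ (γ−J)⁻¹Σ_{z∉Γ}e^{−θ d(x,z)}Σ_{c∈Γ}|A_{zc}||ξ_c|`)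
and the triangle inequality `e^{−θ d(x,z)} ≤ e^{−(θ/2)d(x,c)}e^{(θ/2)d(c,z)}`. [cite: BenfattoEtAl1978, Appendix C (C.7)–(C.8) p.164 (class form); §5 (5.30) p.158] -/
theorem abs_condMean_le_sum_exp {Γ : Finset (B1Eq324BenfattoLemma.Site d)} (hΓ : Γ ⊆ Λ) (ξ : B1Eq324BenfattoLemma.Site d → ℝ)
    {x : B1Eq324BenfattoLemma.Site d} (hx : x ∈ Λ) (hxΓ : x ∉ Γ) :
    |condMean K Γ ξ x| ≤ M₂ / (γA - J) *
      ∑ c : ↥(Γ.subtype (· ∈ Λ)), Real.exp (-(θ / 2 * dist x ((c : Λ) : B1Eq324BenfattoLemma.Site d))) * |ξ ((c : Λ) : B1Eq324BenfattoLemma.Site d)| := by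
  classical
  have hγJ : 0 < γA - J := by linarith
  have hxc : (⟨x, hx⟩ : Λ) ∈ (Γ.subtype (· ∈ Λ))ᶜ := by
    rw [Finset.mem_compl, Finset.mem_subtype]
    exact hxΓ
  rw [condMean_kernel_eq_regression hK hΓ ξ hx]
  have h := B1Eq324BenfattoClassAppendixC.abs_regression_le hAs (dist := fun i j : Λ => dist i j) (fun e => hd0 e)
    (fun e e' => hdsymm e e') (fun e e' e'' => hdtri e e' e'') hγA0 hγA hJ hθ hJγ (Γ.subtype (· ∈ Λ)) (fun j : Λ => ξ j)
    ⟨⟨x, hx⟩, hxc⟩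
  refine h.trans ?_
  -- abbreviations (functions, no definitions)
  set S : Finset ↥Λ := Γ.subtype (· ∈ Λ) with hS
  set e2 : ↥S → ℝ := fun c => Real.exp (-(θ / 2 * dist x ((c : Λ) : B1Eq324BenfattoLemma.Site d))) with he2
  set g : ↥S → ↥Λ → ℝ := fun c z => |A c z| * Real.exp (θ / 2 * dist ((c : Λ) : B1Eq324BenfattoLemma.Site d) (z : B1Eq324BenfattoLemma.Site d)) with hg
  -- pointwise domination
  have hpt : ∀ (z : ↥Sᶜ) (c : ↥S), Real.exp (-(θ * dist x ((z : Λ) : B1Eq324BenfattoLemma.Site d))) * |A z c| ≤ e2 c * g c z := by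
    intro z c
    have htri := hdtri x ((z : Λ) : B1Eq324BenfattoLemma.Site d) ((c : Λ) : B1Eq324BenfattoLemma.Site d)
    have hzc : dist ((z : Λ) : B1Eq324BenfattoLemma.Site d) ((c : Λ) : B1Eq324BenfattoLemma.Site d) = dist ((c : Λ) : B1Eq324BenfattoLemma.Site d) ((z : Λ) : B1Eq324BenfattoLemma.Site d) := hdsymm _ _
    have hdxz : 0 ≤ dist x ((z : Λ) : B1Eq324BenfattoLemma.Site d) := (Real.sqrt_nonneg _).trans (hl2 _ _)
    have hexp : Real.exp (-(θ * dist x ((z : Λ) : B1Eq324BenfattoLemma.Site d))) ≤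
        Real.exp (-(θ / 2 * dist x ((c : Λ) : B1Eq324BenfattoLemma.Site d))) * Real.exp (θ / 2 * dist ((c : Λ) : B1Eq324BenfattoLemma.Site d) ((z : Λ) : B1Eq324BenfattoLemma.Site d)) := by
      rw [← Real.exp_add, Real.exp_le_exp, ← hzc]
      nlinarith
    have hAcz : |A z c| = |A c z| := by rw [hAs]
    rw [hAcz, he2, hg]
    calc Real.exp (-(θ * dist x ((z : Λ) : B1Eq324BenfattoLemma.Site d))) * |A c z|
        ≤ (Real.exp (-(θ / 2 * dist x ((c : Λ) : B1Eq324BenfattoLemma.Site d))) *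
            Real.exp (θ / 2 * dist ((c : Λ) : B1Eq324BenfattoLemma.Site d) ((z : Λ) : B1Eq324BenfattoLemma.Site d))) * |A c z| :=
          mul_le_mul_of_nonneg_right hexp (abs_nonneg _)
      _ = _ := by ring
  -- row by row
  have hrow : ∀ c : ↥S, ∑ z : ↥Sᶜ, Real.exp (-(θ * dist x ((z : Λ) : B1Eq324BenfattoLemma.Site d))) * (|A z c| * |ξ ((c : Λ) : B1Eq324BenfattoLemma.Site d)|) ≤
      M₂ * (e2 c * |ξ ((c : Λ) : B1Eq324BenfattoLemma.Site d)|) := by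
    intro c
    have hξ0 : 0 ≤ |ξ ((c : Λ) : B1Eq324BenfattoLemma.Site d)| := abs_nonneg _
    have he20 : 0 ≤ e2 c := (Real.exp_pos _).le
    have h1 : ∑ z : ↥Sᶜ, Real.exp (-(θ * dist x ((z : Λ) : B1Eq324BenfattoLemma.Site d))) * (|A z c| * |ξ ((c : Λ) : B1Eq324BenfattoLemma.Site d)|) ≤
        ∑ z : ↥Sᶜ, (e2 c * |ξ ((c : Λ) : B1Eq324BenfattoLemma.Site d)|) * g c z := Finset.sum_le_sum fun z _ => by
      calc Real.exp (-(θ * dist x ((z : Λ) : B1Eq324BenfattoLemma.Site d))) * (|A z c| * |ξ ((c : Λ) : B1Eq324BenfattoLemma.Site d)|)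
          = (Real.exp (-(θ * dist x ((z : Λ) : B1Eq324BenfattoLemma.Site d))) * |A z c|) * |ξ ((c : Λ) : B1Eq324BenfattoLemma.Site d)| := by ring
        _ ≤ (e2 c * g c z) * |ξ ((c : Λ) : B1Eq324BenfattoLemma.Site d)| := mul_le_mul_of_nonneg_right (hpt z c) hξ0
        _ = _ := by ring
    have h2 : ∑ z : ↥Sᶜ, g c z ≤ ∑ z : ↥Λ, g c z := by
      rw [Finset.sum_coe_sort Sᶜ (g c)]
      exact Finset.sum_le_univ_sum_of_nonneg fun z => mul_nonneg (abs_nonneg _) (Real.exp_pos _).le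
    have h3 : ∑ z : ↥Λ, g c z ≤ M₂ := hM₂ (c : Λ)
    calc ∑ z : ↥Sᶜ, Real.exp (-(θ * dist x ((z : Λ) : B1Eq324BenfattoLemma.Site d))) * (|A z c| * |ξ ((c : Λ) : B1Eq324BenfattoLemma.Site d)|)
        ≤ ∑ z : ↥Sᶜ, (e2 c * |ξ ((c : Λ) : B1Eq324BenfattoLemma.Site d)|) * g c z := h1
      _ = (e2 c * |ξ ((c : Λ) : B1Eq324BenfattoLemma.Site d)|) * ∑ z : ↥Sᶜ, g c z := by rw [Finset.mul_sum]
      _ ≤ (e2 c * |ξ ((c : Λ) : B1Eq324BenfattoLemma.Site d)|) * M₂ := mul_le_mul_of_nonneg_left (h2.trans h3) (mul_nonneg he20 hξ0)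
      _ = M₂ * (e2 c * |ξ ((c : Λ) : B1Eq324BenfattoLemma.Site d)|) := by ring
  -- the double sum
  have hdouble : ∑ z : ↥Sᶜ, Real.exp (-(θ * dist x ((z : Λ) : B1Eq324BenfattoLemma.Site d))) * ∑ c : ↥S, |A z c| * |ξ ((c : Λ) : B1Eq324BenfattoLemma.Site d)| ≤
      M₂ * ∑ c : ↥S, e2 c * |ξ ((c : Λ) : B1Eq324BenfattoLemma.Site d)| := by
    calc ∑ z : ↥Sᶜ, Real.exp (-(θ * dist x ((z : Λ) : B1Eq324BenfattoLemma.Site d))) * ∑ c : ↥S, |A z c| * |ξ ((c : Λ) : B1Eq324BenfattoLemma.Site d)|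
        = ∑ z : ↥Sᶜ, ∑ c : ↥S, Real.exp (-(θ * dist x ((z : Λ) : B1Eq324BenfattoLemma.Site d))) * (|A z c| * |ξ ((c : Λ) : B1Eq324BenfattoLemma.Site d)|) := by
          refine Finset.sum_congr rfl fun z _ => ?_
          rw [Finset.mul_sum]
      _ = ∑ c : ↥S, ∑ z : ↥Sᶜ, Real.exp (-(θ * dist x ((z : Λ) : B1Eq324BenfattoLemma.Site d))) * (|A z c| * |ξ ((c : Λ) : B1Eq324BenfattoLemma.Site d)|) := Finset.sum_comm
      _ ≤ ∑ c : ↥S, M₂ * (e2 c * |ξ ((c : Λ) : B1Eq324BenfattoLemma.Site d)|) := Finset.sum_le_sum fun c _ => hrow c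
      _ = M₂ * ∑ c : ↥S, e2 c * |ξ ((c : Λ) : B1Eq324BenfattoLemma.Site d)| := by rw [Finset.mul_sum]
  calc 1 / (γA - J) * ∑ z : ↥Sᶜ, Real.exp (-(θ * dist x ((z : Λ) : B1Eq324BenfattoLemma.Site d))) * ∑ c : ↥S, |A z c| * |ξ ((c : Λ) : B1Eq324BenfattoLemma.Site d)|
      ≤ 1 / (γA - J) * (M₂ * ∑ c : ↥S, e2 c * |ξ ((c : Λ) : B1Eq324BenfattoLemma.Site d)|) :=
        mul_le_mul_of_nonneg_left hdouble (by positivity)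
    _ = M₂ / (γA - J) * ∑ c : ↥S, e2 c * |ξ ((c : Λ) : B1Eq324BenfattoLemma.Site d)| := by ring

include hK hL hBΛ hAs hγA0 hγA hd0 hdsymm hdtri hJ hθ hJγ hl2 hM₂ hV₄ hγb in
/-- **ROW (d) — deep inside the box the centre is small**: for `Γ₁ = corridors L w B ⊆ Λ`, every `m ∈ B` whose tessera meets `I`, every datum
`ξ ∈ χ^{Γ₁}_{γb}` and every `x ∈ shrink L m (w + (w − v))`,
`|condMean K Γ₁ ξ x| ≤ (M₂/(γ_A − J))·γb·(1 + √d(L − 1))·V₄·e^{−(θ/4)(w − v)}`: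
the decaying F5 above, `|ξ_c| ≤ γb(1 + d(Δ_c, I)) ≤ γb(1 + d(Δ_x, I))(1 + dist x c)` (`d(Δ_·, I)` 1-Lipschitz for `dist ≥ ℓ²`), `dist x c ≥ w − v` for every
corridor site `c` (the sites of `Γ₁` lie outside `□′∪Γ₂(□)`), the quarter-rate growth row `Σ_{e′}e^{−(θ/4)dist e e′}(1 + dist e e′) ≤ V₄`, and
`d(Δ_x, I) ≤ √d(L − 1)` inside a tessera meeting `I`. [cite: BenfattoEtAl1978, §5 (5.30)–(5.31) p.158, Appendix C (C.8) p.164 (class form)] -/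
theorem abs_condMean_le_deep (hΓΛ : corridors L w B ⊆ Λ) (hBI : ∀ m ∈ B, ∃ x ∈ box L m, x ∈ I) :
    ∀ m ∈ B, ∀ ξ ∈ smallFieldOn (corridors L w B : Set (B1Eq324BenfattoLemma.Site d)) I (γ * b),
      ∀ x ∈ shrink L m (w + (w - v)), |condMean K (corridors L w B) ξ x| ≤
        M₂ / (γA - J) * (γ * b) * (1 + Real.sqrt d * ((L : ℝ) - 1)) * V₄ * Real.exp (-(θ / 4 * ((w - v : ℕ) : ℝ))) := by
  classical
  intro m hm ξ hξ x hx
  have hγJ : 0 < γA - J := by linarith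
  have hPΛ : shrink L m w ⊆ Λ := fun j hj => hBΛ m hm (shrink_subset_box L m w hj)
  have hxw : x ∈ shrink L m w := shrink_mono L m (Nat.le_add_right w (w - v)) hx
  have hxbox : x ∈ box L m := shrink_subset_box L m w hxw
  have hxΛ : x ∈ Λ := hPΛ hxw
  have hxΓ : x ∉ corridors L w B := fun h => Finset.disjoint_left.mp (disjoint_corridors_shrink hL w B m) h hxw
  have hM0 : 0 ≤ M₂ := le_trans (Finset.sum_nonneg fun e' _ => mul_nonneg (abs_nonneg _) (Real.exp_pos _).le) (hM₂ ⟨x, hxΛ⟩)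
  have hC0 : 0 ≤ M₂ / (γA - J) := div_nonneg hM0 hγJ.le
  -- `d(Δ_x, I) ≤ √d(L − 1)`
  obtain ⟨xI, hxI, hxII⟩ := hBI m hm
  have hdx : distToRegion I x ≤ Real.sqrt d * ((L : ℝ) - 1) := by
    have h := distToRegion_le_cubeDist_add_of_box_meets hL hxbox hxI hxII x
    rw [B1Eq324BenfattoSect5SlotMoments.cubeDist_self, zero_add] at h
    exact h
  have hdx0 : 0 ≤ distToRegion I x := distToRegion_nonneg I x
  set a : ℝ := 1 + Real.sqrt d * ((L : ℝ) - 1) with ha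
  have ha1 : 1 + distToRegion I x ≤ a := by rw [ha]; linarith
  have ha0 : 0 ≤ a := le_trans (by linarith) ha1
  set D : ℝ := ((w - v : ℕ) : ℝ) with hD
  -- each boundary term
  set S : Finset ↥Λ := (corridors L w B).subtype (· ∈ Λ) with hS
  have hterm : ∀ c : ↥S,
      Real.exp (-(θ / 2 * dist x ((c : Λ) : B1Eq324BenfattoLemma.Site d))) * |ξ ((c : Λ) : B1Eq324BenfattoLemma.Site d)| ≤
        (γ * b) * a * Real.exp (-(θ / 4 * D)) *
          (Real.exp (-(θ / 4 * dist x ((c : Λ) : B1Eq324BenfattoLemma.Site d))) * (1 + dist x ((c : Λ) : B1Eq324BenfattoLemma.Site d))) := by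
    intro c
    have hcΓ : ((c : Λ) : B1Eq324BenfattoLemma.Site d) ∈ corridors L w B := Finset.mem_subtype.mp c.2
    have hcw : ((c : Λ) : B1Eq324BenfattoLemma.Site d) ∉ shrink L m w := fun h =>
      Finset.disjoint_left.mp (disjoint_corridors_shrink hL w B m) hcΓ h
    have hDc : D ≤ dist x ((c : Λ) : B1Eq324BenfattoLemma.Site d) := by
      rw [hD]
      exact ((B1Eq324BenfattoSect5Eq524.le_cubeDist_of_mem_shrink_of_not_mem_shrink hx hcw).trans
        (cubeDist_le_sqrt_sum_sq x _)).trans (hl2 x _)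
    have ht0 : 0 ≤ dist x ((c : Λ) : B1Eq324BenfattoLemma.Site d) := (Real.sqrt_nonneg _).trans (hl2 _ _)
    -- the datum at `c`
    have hξc : |ξ ((c : Λ) : B1Eq324BenfattoLemma.Site d)| ≤ (γ * b) * a * (1 + dist x ((c : Λ) : B1Eq324BenfattoLemma.Site d)) := by
      have h1 := hξ ((c : Λ) : B1Eq324BenfattoLemma.Site d) (Finset.mem_coe.mpr hcΓ)
      have h2 : distToRegion I ((c : Λ) : B1Eq324BenfattoLemma.Site d) ≤ distToRegion I x + dist x ((c : Λ) : B1Eq324BenfattoLemma.Site d) := by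
        have h := (abs_sub_le_iff.mp (abs_distToRegion_sub_distToRegion_le_sqrt I ((c : Λ) : B1Eq324BenfattoLemma.Site d) x)).1
        have hsymm : Real.sqrt (∑ j, (((((c : Λ) : B1Eq324BenfattoLemma.Site d) j : ℝ) - (x j : ℝ))) ^ 2) =
            Real.sqrt (∑ j, (((x j : ℝ) - (((c : Λ) : B1Eq324BenfattoLemma.Site d) j : ℝ))) ^ 2) := by
          congr 1
          exact Finset.sum_congr rfl fun j _ => by ring
        rw [hsymm] at h
        linarith [hl2 x ((c : Λ) : B1Eq324BenfattoLemma.Site d)]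
      have h3 : 1 + distToRegion I ((c : Λ) : B1Eq324BenfattoLemma.Site d) ≤ a * (1 + dist x ((c : Λ) : B1Eq324BenfattoLemma.Site d)) := by
        have : 1 + distToRegion I x + dist x ((c : Λ) : B1Eq324BenfattoLemma.Site d) ≤ (1 + distToRegion I x) * (1 + dist x ((c : Λ) : B1Eq324BenfattoLemma.Site d)) := by
          nlinarith
        nlinarith
      calc |ξ ((c : Λ) : B1Eq324BenfattoLemma.Site d)| ≤ γ * b * (1 + distToRegion I ((c : Λ) : B1Eq324BenfattoLemma.Site d)) := h1
        _ ≤ γ * b * (a * (1 + dist x ((c : Λ) : B1Eq324BenfattoLemma.Site d))) := mul_le_mul_of_nonneg_left h3 hγb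
        _ = (γ * b) * a * (1 + dist x ((c : Λ) : B1Eq324BenfattoLemma.Site d)) := by ring
    -- the exponential: `e^{−(θ/2)t} = e^{−(θ/4)t}·e^{−(θ/4)t} ≤ e^{−(θ/4)D}·e^{−(θ/4)t}`
    have hex : Real.exp (-(θ / 2 * dist x ((c : Λ) : B1Eq324BenfattoLemma.Site d))) ≤
        Real.exp (-(θ / 4 * D)) * Real.exp (-(θ / 4 * dist x ((c : Λ) : B1Eq324BenfattoLemma.Site d))) := by
      rw [← Real.exp_add, Real.exp_le_exp]
      nlinarith
    calc Real.exp (-(θ / 2 * dist x ((c : Λ) : B1Eq324BenfattoLemma.Site d))) * |ξ ((c : Λ) : B1Eq324BenfattoLemma.Site d)|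
        ≤ (Real.exp (-(θ / 4 * D)) * Real.exp (-(θ / 4 * dist x ((c : Λ) : B1Eq324BenfattoLemma.Site d)))) *
            ((γ * b) * a * (1 + dist x ((c : Λ) : B1Eq324BenfattoLemma.Site d))) :=
          mul_le_mul hex hξc (abs_nonneg _) (by positivity)
      _ = _ := by ring
  -- sum over the corridor sites, then the growth row
  have hsum : ∑ c : ↥S, Real.exp (-(θ / 2 * dist x ((c : Λ) : B1Eq324BenfattoLemma.Site d))) * |ξ ((c : Λ) : B1Eq324BenfattoLemma.Site d)| ≤
      (γ * b) * a * Real.exp (-(θ / 4 * D)) * V₄ := by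
    have h1 : ∑ c : ↥S, Real.exp (-(θ / 4 * dist x ((c : Λ) : B1Eq324BenfattoLemma.Site d))) * (1 + dist x ((c : Λ) : B1Eq324BenfattoLemma.Site d)) ≤ V₄ := by
      have h2 : ∑ c : ↥S, Real.exp (-(θ / 4 * dist x ((c : Λ) : B1Eq324BenfattoLemma.Site d))) * (1 + dist x ((c : Λ) : B1Eq324BenfattoLemma.Site d)) ≤
          ∑ e' : ↥Λ, Real.exp (-(θ / 4 * dist x (e' : B1Eq324BenfattoLemma.Site d))) * (1 + dist x (e' : B1Eq324BenfattoLemma.Site d)) := by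
        rw [Finset.sum_coe_sort S (fun e' : ↥Λ => Real.exp (-(θ / 4 * dist x (e' : B1Eq324BenfattoLemma.Site d))) * (1 + dist x (e' : B1Eq324BenfattoLemma.Site d)))]
        exact Finset.sum_le_univ_sum_of_nonneg fun e' => mul_nonneg (Real.exp_pos _).le
          (by linarith [(Real.sqrt_nonneg _).trans (hl2 x (e' : B1Eq324BenfattoLemma.Site d))])
      exact h2.trans (hV₄ ⟨x, hxΛ⟩)
    calc ∑ c : ↥S, Real.exp (-(θ / 2 * dist x ((c : Λ) : B1Eq324BenfattoLemma.Site d))) * |ξ ((c : Λ) : B1Eq324BenfattoLemma.Site d)|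
        ≤ ∑ c : ↥S, (γ * b) * a * Real.exp (-(θ / 4 * D)) *
            (Real.exp (-(θ / 4 * dist x ((c : Λ) : B1Eq324BenfattoLemma.Site d))) * (1 + dist x ((c : Λ) : B1Eq324BenfattoLemma.Site d))) := Finset.sum_le_sum fun c _ => hterm c
      _ = (γ * b) * a * Real.exp (-(θ / 4 * D)) *
            ∑ c : ↥S, Real.exp (-(θ / 4 * dist x ((c : Λ) : B1Eq324BenfattoLemma.Site d))) * (1 + dist x ((c : Λ) : B1Eq324BenfattoLemma.Site d)) := by rw [Finset.mul_sum]
      _ ≤ (γ * b) * a * Real.exp (-(θ / 4 * D)) * V₄ := mul_le_mul_of_nonneg_left h1 (by positivity)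
  have hmain := abs_condMean_le_sum_exp hK hAs hγA0 hγA hd0 hdsymm hdtri hJ hθ hJγ hl2 hM₂ hΓΛ ξ hxΛ hxΓ
  calc |condMean K (corridors L w B) ξ x|
      ≤ M₂ / (γA - J) * ∑ c : ↥S, Real.exp (-(θ / 2 * dist x ((c : Λ) : B1Eq324BenfattoLemma.Site d))) * |ξ ((c : Λ) : B1Eq324BenfattoLemma.Site d)| := hmain
    _ ≤ M₂ / (γA - J) * ((γ * b) * a * Real.exp (-(θ / 4 * D)) * V₄) := mul_le_mul_of_nonneg_left hsum hC0
    _ = M₂ / (γA - J) * (γ * b) * a * V₄ * Real.exp (-(θ / 4 * D)) := by ring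

include hK hL hBΛ hAs hγA0 hγA hd0 hdsymm hdtri hJ hθ hJγ hl2 hM₂ hV₄ hγb in
/-- **ROW (d) in the cluster side's letters**: with `ε₃₁ ≥ (M₂/(γ_A − J))·γb·(1 + √d(L − 1))·V₄·e^{−(θ/4)(w − v)}`,
`∀ m ∈ B, ∀ ξ ∈ χ^{Γ₁}_{γb}, ∀ x ∈ shrink L m (w + (w − v)), |condMean K Γ₁ ξ x| ≤ ε₃₁` (every tessera of `B` meeting `I`).
[cite: BenfattoEtAl1978, §5 (5.30)–(5.31) p.158 (class form)] -/
theorem abs_condMean_le_deep_of_le (hΓΛ : corridors L w B ⊆ Λ) (hBI : ∀ m ∈ B, ∃ x ∈ box L m, x ∈ I) {ε₃₁ : ℝ}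
    (hε : M₂ / (γA - J) * (γ * b) * (1 + Real.sqrt d * ((L : ℝ) - 1)) * V₄ * Real.exp (-(θ / 4 * ((w - v : ℕ) : ℝ))) ≤ ε₃₁) :
    ∀ m ∈ B, ∀ ξ ∈ smallFieldOn (corridors L w B : Set (B1Eq324BenfattoLemma.Site d)) I (γ * b),
      ∀ x ∈ shrink L m (w + (w - v)), |condMean K (corridors L w B) ξ x| ≤ ε₃₁ :=
  fun m hm ξ hξ x hx =>
    (abs_condMean_le_deep hK hL hBΛ hAs hγA0 hγA hd0 hdsymm hdtri hJ hθ hJγ hl2 hM₂ hV₄ hγb hΓΛ hBI m hm ξ hξ x hx).trans hε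

end CentreDepth

/-! ## §5 (v1.1, APPEND-ONLY)  The class kernel's own `ℓ¹` row — row (b) at `K = K_Λ` itself

Seat n08-b gen 12 LOCATED (2026-08-28T08:33Z) that the free side's class instance reads rows (a), (b), (g) at the class kernel `K = K_Λ`
itself (the reference field of the identification), not only at the part kernels: (a) is `abs_kernel_le` and (g) is `kernel_self_le'` of v1;
this section adds (b) at `K`. -/

section KernelL1

variable {Λ : Finset (B1Eq324BenfattoLemma.Site d)} {A : Matrix Λ Λ ℝ}
  {K : B1Eq324BenfattoLemma.Site d → B1Eq324BenfattoLemma.Site d → ℝ}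
  (hK : ∀ x y, K x y = if h : x ∈ Λ ∧ y ∈ Λ then (A⁻¹ : Matrix Λ Λ ℝ) ⟨x, h.1⟩ ⟨y, h.2⟩ else 0)
  (hAs : ∀ e e', A e e' = A e' e) {γA : ℝ} (hγA0 : 0 < γA)
  (hγA : ∀ x : Λ → ℝ, γA * ∑ e, x e ^ 2 ≤ ∑ e, ∑ e', A e e' * x e * x e')
  {dist : B1Eq324BenfattoLemma.Site d → B1Eq324BenfattoLemma.Site d → ℝ}
  (hd0 : ∀ e, dist e e = 0) (hdsymm : ∀ e e', dist e e' = dist e' e) (hdtri : ∀ e e' e'', dist e e'' ≤ dist e e' + dist e' e'')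
  {J θ : ℝ}
  (hJ : ∀ e : Λ, ∑ e' : Λ, |A e e'| * (Real.cosh (θ * dist (e : B1Eq324BenfattoLemma.Site d) (e' : B1Eq324BenfattoLemma.Site d)) - 1) ≤ J)
  (hθ : 0 ≤ θ) (hJγ : J < γA)
  (hl2 : ∀ x y : B1Eq324BenfattoLemma.Site d, Real.sqrt (∑ j, (((x j : ℝ) - (y j : ℝ))) ^ 2) ≤ dist x y)

include hK hAs hγA0 hγA hd0 hdsymm hdtri hJ hθ hJγ hl2 in
/-- **ROW (b) AT THE CLASS KERNEL ITSELF — `ℓ¹` decay at rate `θ/√d`**: for all `x, y`,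
`|K x y| ≤ (1/(γ_A − J))·exp(−(θ/√d)·Σ_j|x_j − y_j|)` (J1 F2 `abs_kernel_le_exp` + `ℓ¹ ≤ √d·ℓ² ≤ √d·dist`) — the reference kernel's decay row
for the free side's class instance (seat n08-b). [cite: BenfattoEtAl1978, Appendix C (C.2) p.164 (class form); §5 (5.31) p.158] -/
theorem abs_kernel_le_exp_l1 (x y : B1Eq324BenfattoLemma.Site d) :
    |K x y| ≤ 1 / (γA - J) * Real.exp (-(θ / Real.sqrt d * ∑ j, |((x j : ℝ) - (y j : ℝ))|)) := by
  have hγJ : 0 < γA - J := by linarith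
  refine (abs_kernel_le_exp hK hAs hd0 hdsymm hdtri hγA0 hγA hJ hθ hJγ x y).trans ?_
  rw [div_eq_mul_inv, mul_comm, one_div]
  refine mul_le_mul_of_nonneg_left (Real.exp_le_exp.mpr (neg_le_neg ?_)) (inv_nonneg.mpr hγJ.le)
  by_cases hd : d = 0
  · subst hd
    simp only [Finset.univ_eq_empty, Finset.sum_empty, mul_zero]
    exact mul_nonneg hθ ((Real.sqrt_nonneg _).trans (hl2 x y))
  · have hsd : 0 < Real.sqrt d := Real.sqrt_pos.mpr (by exact_mod_cast Nat.pos_of_ne_zero hd)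
    have h1 := l1_le_sqrt_mul_l2 x y
    have h2 := hl2 x y
    calc θ / Real.sqrt d * ∑ j, |((x j : ℝ) - (y j : ℝ))|
        ≤ θ / Real.sqrt d * (Real.sqrt d * Real.sqrt (∑ j, (((x j : ℝ) - (y j : ℝ))) ^ 2)) :=
          mul_le_mul_of_nonneg_left h1 (div_nonneg hθ hsd.le)
      _ = θ * Real.sqrt (∑ j, (((x j : ℝ) - (y j : ℝ))) ^ 2) := by field_simp
      _ ≤ θ * dist x y := mul_le_mul_of_nonneg_left h2 hθ

end KernelL1

end Literature.MathematicalPhysics.QuantumFieldTheory.Balaban1983to89.B1Eq324BenfattoKernelSect5PartFieldRows
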